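import Literature.MathematicalPhysics.QuantumFieldTheory.Balaban1983to89.B9Thm313WholeInput
import Literature.MathematicalPhysics.QuantumFieldTheory.Balaban1983to89.B9Thm313WholeHolderZ

/-!
# `Balaban1983to89.B9Thm313WholeInputZ` — [B9] Theorem 3.13 (p. 426): the two INPUT-HÖLDER lines (3.44), (3.45) of 𝔊 = 𝔓G₁ with the COARSE-FIELD LETTERS
# RE-CLASSED (Z-twin of `B9Thm313WholeInput`; R1-cls of the cell's located «C-LETTER-FLAT-AT-ONE»; sequel of `B9Thm313WholeZ ∕ LeftZ ∕ HolderZ`)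

T. Bałaban, *Propagators for lattice gauge theories in a background field*, Commun. Math. Phys. **99** (1985) 389–434
[`Balaban1985BackgroundPropagators`, "B9"]; [4] = T. Bałaban, *Propagators and renormalization transformations for lattice
gauge theories. II*, Commun. Math. Phys. **96** (1984) 223–250 [`Balaban1984PropagatorsII`].  statement-level skeleton of published
theorems with citation tags; proofs where landed; nothing here is a claim about the Yang–Mills mass gap.

THE POINT.  `B9Thm313WholeInput` reads ∇_UG₁Q\* ∕ Φ∇_UG₁Q\* out of the FLAT coarse class Z⁰ and moves them to Z^{len} = 𝔠_Z^{(1)} by print's scale transfer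
(2.60) (`hasMaj_transfer`), to meet (QG₁Q\*)⁻¹ read INTO Z^{len} (`Letters313.c1_1`).  With the coarse class re-weighted (`B9Thm313WholeZ`: `Z_{wZ}`,
`Z_{len·wZ}`) the same passage needs (2.60) for a WEIGHTED source class — §0 `hasMaj_transfer_weight` (the proof of `B9Thm312WholeClasses.hasMaj_transfer`
with the source power weight replaced by a free weight: Z_{w} → 𝔠^{(s)} becomes Z_{len·w} → 𝔠^{(s+1)}, constant ×Λ, rate ×(1−α)).  Then:
* §2 `GG_input_of_piecesZ` — (3.153) with a left factor E and ∇\* on the right, the G₁Q\* piece sourced at `Z_{len·wZ}`, `hL : Letters313Z`;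
* §3 ★ `GG_input44_of_lettersZ`, ★ `GG_input45_of_lettersZ` — the statements of `GG_input44_of_letters ∕ GG_input45_of_letters` over `Letters313Z ∕
  Letters313DZ` (`hpQ` out of `Z_{wZ}`); SAME conclusions and constants `constI44 ∕ constI45`; proofs verbatim but for the weighted step and transfer.
`wZ ≡ 1` recovers the flat statements.

HONEST SCOPE.  Nothing of print is asserted: the letters are HYPOTHESES of printed ∕ md shape; kernel-checked bookkeeping.  NOT a node discharge, NOT
summit progress; one finite lattice at a time; nothing continuum, nothing about the mass gap.  Cell `pub-ymgap` (HUMAN RULING D-0062), Track A node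
N06 [B9], N06-ASSIGNMENT v1 row 21 (bundle F7), seat `pub-ymgap-dag-n06-l` (g14), 2026-08-27.  NEW file; nothing landed is modified.
-/

namespace Literature.MathematicalPhysics.QuantumFieldTheory.Balaban1983to89.B9Thm313WholeInputZ

open Literature.MathematicalPhysics.QuantumFieldTheory.Balaban1983to89
open Finset B6RandomWalk B6RandomWalkHom B9Thm34Ext B9Thm37GlueCor36 B11SectG B9SectDSup
open B9Thm37AllNorms B9Thm37AllNormsInstances B9Thm312Whole B9Thm312WholeLeaf B9Thm312WholeLeft B9Thm313Whole B9Thm313WholeLeft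
open B9RWSums343Holder B9Ineq347 B9Thm312WholeClasses B9Thm312WholeHolder B9Thm312WholeHHolder B9Thm313WholeHolder B9Thm313WholeInput
open B9Thm313WholeZ B9Thm313WholeLeftZ B9Thm313WholeHolderZ

noncomputable section

/-! ## §0 Print's scale transfer (2.60) for a weighted source class -/

section Transfer

variable {g : B9.Geometry} {X V : Type} [Fintype X] [Fintype V] [Fintype g.Site]
variable {R₀ : ℝ} {H₀ : Prop}

/-- ★ **THE SCALE TRANSFER OF p. 398 FOR A WEIGHTED SOURCE CLASS** (`B9Thm312WholeClasses.hasMaj_transfer` with the source power weight (L^{j′}η)^t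
replaced by a free weight w(y′) ≧ 0, exponent γ = 1): a majorant C·e^{−ρd} from Z_{w} = `weightNorm (ofBlocks blkV) w` to 𝔠^{(s)} is the majorant
C·Λ·e^{−(1−α)ρd} from Z_{len·w} to 𝔠^{(s+1)} whenever e^{−αρd(y,y′)}Lʲη ≦ Λ·L^{j′}η (`ScaleTransfer`) — *"we may replace the factor (Lʲη)^α by
(Lʲη)^β(L^{j′}η)^γ with β + γ = α"*. [cite: Balaban1985BackgroundPropagators, p.398 (remark after (3.47)); Balaban1984PropagatorsII, Lemma 2.1 (2.60) p.234] -/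
theorem hasMaj_transfer_weight (hG : GeoOK g) {blkV : V → g.Site} {blk : X → g.Site} {T : (V → ℝ) →ₗ[ℝ] (X → ℝ)}
    {w : g.Site → ℝ} (hw : ∀ y, 0 ≤ w y) {C ρ α Λ s : ℝ} (hC : 0 ≤ C) (hST : ScaleTransfer g ρ α Λ (fun y => g.len y ^ (1 : ℝ)))
    (h : HasMaj (weightNorm (BlockNorm.ofBlocks (toB6 g R₀ H₀) blkV) w hw) (cNormR R₀ H₀ blk hG.lenle s) T
      (fun a b => C * Real.exp (-(ρ * g.dist a b)))) :
    HasMaj (weightNorm (BlockNorm.ofBlocks (toB6 g R₀ H₀) blkV) (fun y => g.len y * w y) fun y => mul_nonneg (hG.lenle y) (hw y))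
      (cNormR R₀ H₀ blk hG.lenle (s + 1)) T (fun a b => C * Λ * Real.exp (-((1 - α) * ρ * g.dist a b))) := by
  intro y' μ hμ y
  have hb := h y' μ hμ y
  rw [weightNorm_loc, cNormR_loc] at hb
  rw [weightNorm_loc, cNormR_loc, Real.rpow_add (hG.lenpos y), Real.rpow_one]
  set N := (BlockNorm.ofBlocks (toB6 g R₀ H₀) blk).loc y (T μ) with hN
  set N' := (BlockNorm.ofBlocks (toB6 g R₀ H₀) blkV).loc y' μ with hN'
  have hN'0 : 0 ≤ N' := (BlockNorm.ofBlocks (toB6 g R₀ H₀) blkV).loc_nonneg y' μ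
  have hw0 : 0 ≤ w y' := hw y'
  -- the transfer at (y′, y): e^{−αρd(y′,y)} Lʲη ≦ Λ L^{j′}η
  have hst : Real.exp (-(α * ρ * g.dist y y')) * g.len y ≤ Λ * g.len y' := by
    have h1 := hST y' y
    simp only [hG.symm y' y, Real.rpow_one] at h1
    exact h1
  have hsplit : Real.exp (-(ρ * g.dist y y')) =
      Real.exp (-((1 - α) * ρ * g.dist y y')) * Real.exp (-(α * ρ * g.dist y y')) := by
    rw [← Real.exp_add]; congr 1; ring
  have hE : 0 ≤ C * Real.exp (-((1 - α) * ρ * g.dist y y')) := mul_nonneg hC (Real.exp_nonneg _)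
  have hs0 : 0 ≤ g.len y ^ s := Real.rpow_nonneg (hG.lenle y) s
  calc g.len y ^ s * g.len y * N = g.len y * (g.len y ^ s * N) := by ring
    _ ≤ g.len y * (C * Real.exp (-(ρ * g.dist y y')) * (w y' * N')) := mul_le_mul_of_nonneg_left hb (hG.lenle y)
    _ = C * Real.exp (-((1 - α) * ρ * g.dist y y')) * (Real.exp (-(α * ρ * g.dist y y')) * g.len y) * (w y' * N') := by
        rw [hsplit]; ring
    _ ≤ C * Real.exp (-((1 - α) * ρ * g.dist y y')) * (Λ * g.len y') * (w y' * N') :=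
        mul_le_mul_of_nonneg_right (mul_le_mul_of_nonneg_left hst hE) (mul_nonneg hw0 hN'0)
    _ = C * Λ * Real.exp (-((1 - α) * ρ * g.dist y y')) * (g.len y' * w y' * N') := by ring

end Transfer

/-! ## §2 (3.153) with a left factor and ∇\* on the right, the G₁Q\* piece out of the weighted class -/

section OneMember

variable {g : B9.Geometry} {B : B9.Backgrounds} {X Y Z W PX PY : Type}
variable [Fintype X] [Fintype Y] [Fintype Z] [Fintype W] [Fintype PX] [Fintype PY] [Fintype g.Site]
variable {R₀ : ℝ} {H₀ : Prop}

omit [Fintype PX] [Fintype PY] in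
/-- ★ **(3.153) WITH A LEFT FACTOR E, THE RIGHT FACTOR ∇\*_U READ FROM AN INPUT CLASS** `bA` (dominating the block sup norm): E𝔊∇\* = EG₁∇\* −
(EG₁D)(RD\*G₁∇\*) − (EG₁Q*)(C₁QG₁∇\*) (`E_GG_F_eq`), composed by `hasMaj_frakG_classes` with the classes bA → bC (output), `bP` (the W-Hölder
class of RD\*G₁∇\*), Z^{(1)} = `cNorm … 1` and 𝔠_Z^{(1)} = `cNormR … 1` for C₁ (`Letters313.c1_1`): the E-dependent pieces EG₁∇\* (K₄₄), EG₁D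
(K_D), EG₁Q* (K_Q, out of 𝔠_Z^{(1)}) at the common rate ρ₂ are hypotheses; QG₁∇\* is built from the proved sup entry G₁∇\*_U
(`entry2_of_step` at the rate r: Theorem 3.3 (3.42)₃ for G₀ + the step on 𝔠⁽¹⁾), the domination `bA ≧ |·|` and the local letter Q (`q1`);
provisos ρ₄ + 2σ ≦ ρ₂ ≦ r, ρ₂ + σ ≦ δ₃, r ≦ δ₀, r + σ ≦ δ_K, θc < 1.
[cite: Balaban1985BackgroundPropagators, Thm 3.13 p.426 + (3.153) p.426 + (3.44)–(3.45) p.398 + (3.132) p.422; Balaban1984PropagatorsII, Lemma 2.1 (2.61) p.234] -/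
theorem GG_input_of_piecesZ (hG : GeoOK g) {𝔬 : Ops g B X Y Z W} {U : B.Cfg} {P : Type}
    {bA : BlockNorm (toB6 g R₀ H₀) (Y → ℝ)} {bP : BlockNorm (toB6 g R₀ H₀) (W → ℝ)} {bC : BlockNorm (toB6 g R₀ H₀) (P → ℝ)}
    {E : (X → ℝ) →ₗ[ℝ] (P → ℝ)} {θ B₀ B₃ Br K44 KD KQ δ₀ δ₃ δK r ρ₂ ρ₄ σ c : ℝ}
    (hrow : RowSum (toB6 g R₀ H₀) σ c) (hc : 0 ≤ c) (hθ : 0 ≤ θ) (hB₀ : 0 ≤ B₀) (hB₃ : 0 ≤ B₃) (hBr : 0 ≤ Br) (hK44 : 0 ≤ K44)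
    (hKD : 0 ≤ KD) (hKQ : 0 ≤ KQ) (hσ : 0 ≤ σ) (hρ₄ : 0 ≤ ρ₄) (hρ₄₂ : ρ₄ + 2 * σ ≤ ρ₂) (hρ₂r : ρ₂ ≤ r) (hρ₂₃ : ρ₂ + σ ≤ δ₃)
    (hr : 0 ≤ r) (hr0 : r ≤ δ₀) (hrK : r + σ ≤ δK) (hq : θ * c < 1)
    (hK1 : HasMaj (cNorm R₀ H₀ 𝔬.blk hG.lenle 1) (cNorm R₀ H₀ 𝔬.blk hG.lenle 1) (𝔬.G0 U ∘ₗ (𝔬.Tpi U + 𝔬.T2 U))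
      (fun a b => θ * Real.exp (-(δK * g.dist a b))))
    (he2 : HasMajorantHom (g := toB6 g R₀ H₀) 𝔬.blkY 𝔬.blk (𝔬.G0 U ∘ₗ 𝔬.Dstar U)
      (fun (a b : g.Site) => B₀ * g.len a * Real.exp (-(δ₀ * g.dist a b))))
    {wZ : g.Site → ℝ} {hwZ : ∀ y, 0 < wZ y} (hL : Letters313Z 𝔬 R₀ H₀ hG wZ hwZ B₃ δ₃ U) (hI : Identities 𝔬 U)
    (hdom : ∀ (y : g.Site) (μ : Y → ℝ), (BlockNorm.ofBlocks (toB6 g R₀ H₀) 𝔬.blkY).loc y μ ≤ bA.loc y μ)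
    (hloc : ∀ (y : g.Site) (μ : Y → ℝ), bA.IsLoc y μ → (BlockNorm.ofBlocks (toB6 g R₀ H₀) 𝔬.blkY).IsLoc y μ)
    (hRG : HasMaj bA bP (𝔬.R U ∘ₗ 𝔬.Dvstar U ∘ₗ 𝔬.G1 U ∘ₗ 𝔬.Dstar U) (fun a b => Br * Real.exp (-(δ₃ * g.dist a b))))
    (hGop : HasMaj bA bC (E ∘ₗ (𝔬.G1 U ∘ₗ 𝔬.Dstar U)) (fun a b => K44 * Real.exp (-(ρ₂ * g.dist a b))))
    (hGD : HasMaj bP bC (E ∘ₗ (𝔬.G1 U ∘ₗ 𝔬.Dv U)) (fun a b => KD * Real.exp (-(ρ₂ * g.dist a b))))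
    (hGQ : HasMaj (weightNorm (BlockNorm.ofBlocks (toB6 g R₀ H₀) 𝔬.blkZ) (fun y => g.len y * wZ y) fun y => (wZlen_pos hG hwZ y).le) bC
      (E ∘ₗ 𝔬.G1 U ∘ₗ 𝔬.Qstar U) (fun a b => KQ * Real.exp (-(ρ₂ * g.dist a b)))) :
    HasMaj bA bC (E ∘ₗ (𝔬.GG U ∘ₗ 𝔬.Dstar U))
      (fun a b => (K44 + bP.κ * KD * Br * c + KQ * (B₃ * (B₃ * (B₀ * (1 - θ * c)⁻¹) * c) * c) * c) *
        Real.exp (-(ρ₄ * g.dist a b))) := by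
  have htri : Triangle254 (toB6 g R₀ H₀) := fun a b c => hG.tri a b c
  have hfix1 := fix_of_inverses hI.invG0' hI.invG1
  have hq1 : 0 ≤ (1 - θ * c)⁻¹ := inv_nonneg.mpr (by linarith)
  have hA₁ : 0 ≤ B₀ * (1 - θ * c)⁻¹ := mul_nonneg hB₀ hq1
  have hρ₂0 : 0 ≤ ρ₂ := by linarith
  have hρ₂₃' : ρ₂ ≤ δ₃ := by linarith
  -- QG₁∇* : bA → Z^{(1)} — G₁∇* from the proved sup entry, the domination, the local letter Q
  have hm2 := entry2_of_step hG hrow hθ hB₀ hr hr0 hrK hK1 he2 hfix1 hq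
  have h20 : HasMaj (BlockNorm.ofBlocks (toB6 g R₀ H₀) 𝔬.blkY) (BlockNorm.ofBlocks (toB6 g R₀ H₀) 𝔬.blk) (𝔬.G1 U ∘ₗ 𝔬.Dstar U)
      (fun a b => B₀ * (1 - θ * c)⁻¹ * g.len a * Real.exp (-(r * g.dist a b))) :=
    hasMaj_of_hasMajorantHom (G := toB6 g R₀ H₀) 𝔬.blkY 𝔬.blk
      (fun a b => mul_nonneg (mul_nonneg hA₁ (hG.lenle a)) (Real.exp_nonneg _)) hm2
  have h2c : HasMaj (cNorm R₀ H₀ 𝔬.blkY hG.lenle 0) (cNorm R₀ H₀ 𝔬.blk hG.lenle 1) (𝔬.G1 U ∘ₗ 𝔬.Dstar U)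
      (fun a b => B₀ * (1 - θ * c)⁻¹ * Real.exp (-(r * g.dist a b))) := by
    refine (hasMaj_cNorm_of_hasMaj hG 1 0 h20).mono fun y y' => le_of_eq ?_
    have hy : g.len y ≠ 0 := (hG.lenpos y).ne'
    simp only [wt, pow_zero, pow_one, mul_one]
    rw [mul_assoc (B₀ * (1 - θ * c)⁻¹), mul_comm (g.len y), ← mul_assoc (B₀ * (1 - θ * c)⁻¹), mul_assoc,
      mul_inv_cancel₀ hy, mul_one]
  have h2o : HasMaj (BlockNorm.ofBlocks (toB6 g R₀ H₀) 𝔬.blkY) (cNorm R₀ H₀ 𝔬.blk hG.lenle 1) (𝔬.G1 U ∘ₗ 𝔬.Dstar U)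
      (fun a b => B₀ * (1 - θ * c)⁻¹ * Real.exp (-(r * g.dist a b))) := by
    have h := hasMaj_toR_src hG h2c
    simp only [Nat.cast_zero, neg_zero] at h
    exact hasMaj_of_in_zero h
  have h2A : HasMaj bA (cNorm R₀ H₀ 𝔬.blk hG.lenle 1) (𝔬.G1 U ∘ₗ 𝔬.Dstar U)
      (fun a b => B₀ * (1 - θ * c)⁻¹ * Real.exp (-(r * g.dist a b))) :=
    hasMaj_of_dom hdom hloc (fun a b => mul_nonneg hA₁ (Real.exp_nonneg _)) h2o
  have hQG : HasMaj bA (cNorm R₀ H₀ 𝔬.blkZ hG.lenle 1) (𝔬.Q U ∘ₗ (𝔬.G1 U ∘ₗ 𝔬.Dstar U))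
      (fun a b => (cNorm R₀ H₀ 𝔬.blk hG.lenle 1 (X := X)).κ * B₃ * (B₀ * (1 - θ * c)⁻¹) * c *
        Real.exp (-(ρ₂ * g.dist a b))) :=
    hasMaj_comp_exp htri hG.dnn hrow hB₃ hA₁ hρ₂0 hρ₂r hρ₂₃ hL.q1 h2A
  simp only [cNorm_κ, one_mul] at hQG
  -- C₁ : Z^{(1)} → Z_{len·wZ}
  have hC : HasMaj (cNorm R₀ H₀ 𝔬.blkZ hG.lenle 1) (weightNorm (BlockNorm.ofBlocks (toB6 g R₀ H₀) 𝔬.blkZ) (fun y => g.len y * wZ y) fun y => (wZlen_pos hG hwZ y).le)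
      (𝔬.C1 U) (fun a b => B₃ * Real.exp (-(δ₃ * g.dist a b))) := hL.c1_1
  have hBQ0 : 0 ≤ B₃ * (B₀ * (1 - θ * c)⁻¹) * c := mul_nonneg (mul_nonneg hB₃ hA₁) hc
  -- (3.153) composed
  have hfr := hasMaj_frakG_classes htri hG.dnn hrow hK44 hKD hBr hKQ hB₃ hBQ0 hρ₄ hσ hρ₄₂ hGop hGD
    (hRG.of_rate_le hG.dnn hBr hρ₂₃') hGQ (hC.of_rate_le hG.dnn hB₃ hρ₂₃') hQG
  have hGG := hfr.congr (T' := E ∘ₗ (𝔬.GG U ∘ₗ 𝔬.Dstar U)) fun μ => by rw [E_GG_F_eq hI E (𝔬.Dstar U)]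
  refine hGG.mono fun a b => le_of_eq ?_
  simp only [cNorm_κ, weightNorm_ofBlocks_κ, one_mul, toB6_dist]

/-! ## §3 The two input-Hölder lines of 𝔊 = 𝔓G₁ over the re-classed letters -/

omit [Fintype PX] in
/-- ★ **(3.44) FOR 𝔊 = 𝔓G₁, PRINTED SHAPE, COARSE LETTERS RE-CLASSED** (statement of `B9Thm313WholeInput.GG_input44_of_letters` over `Letters313Z ∕
Letters313DZ`) — ∇_U𝔊∇\*_U read from the input Hölder class `bHY ε` into the block sup norm: |(∇_U𝔊∇\*_Uμ)(b)| ≦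
K·e^{−ρ₄d(y,y′)}(‖μ‖_ε + |μ|) for b ∈ Δ(y), supp μ ⊂ Δ̃(y′) (the input `h44` of n06-k's `lines3445_of_hasMaj_rel`), K = `constI44 … (bHW ε).κ c`.
Route: (3.153) with E = ∇_U (`GG_input_of_pieces`); ∇_UG₁∇\*_U and ∇_UG₁D by r1's right form (`input44_of_step` from Theorem 3.3 (3.44) for G₀ ∕ the
letter `dgDv`, the steps `tD1` ∕ `tDv`, the proved ∇_UG₁ sup entry transferred by (2.60)); ∇_UG₁Q* by `hasMaj_left_right` (letters `Letters313DZ.dgQs`, `Letters313Z.gQs2`, coarse class `Z_{wZ}`)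
transferred by (2.60) (`hasMaj_transfer_weight`) to Z_{len·wZ} → 𝔠_Y^{(0)}.  Provisos: ρ₄ + 3σ ≦ (1 − α)r, r ≦ δ₀, r ≦ δ₃, r + σ ≦ δ_K, θc < 1.
[cite: Balaban1985BackgroundPropagators, Thm 3.13 p.426 + (3.153) p.426 + (3.44) p.398 + Thm 3.12 p.423 + p.398 (remark after (3.47)); Balaban1984PropagatorsII, Lemma 2.1 (2.60)–(2.61) p.234] -/
theorem GG_input44_of_lettersZ (hG : GeoOK g) (𝔭 : HolderProbes g B X Y PX PY) {𝔬 : Ops g B X Y Z W} {U : B.Cfg}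
    {bHY : ℝ → BlockNorm (toB6 g R₀ H₀) (Y → ℝ)} {bHW : ℝ → BlockNorm (toB6 g R₀ H₀) (W → ℝ)} {bH : BlockNorm (toB6 g R₀ H₀) (W → ℝ)}
    {Bd : ℝ → ℝ} {Bd2 : ℝ → ℝ → ℝ} {θ θ' θH θv B₀ B₃ Bi Br δ₀ δ₃ δK r ρ₄ α Λ σ c ε : ℝ} (hrow : RowSum (toB6 g R₀ H₀) σ c)
    (hc : 0 ≤ c) (hθ : 0 ≤ θ) (hθ' : 0 ≤ θ') (hθH : 0 ≤ θH) (hθv : 0 ≤ θv) (hB₀ : 0 ≤ B₀) (hB₃ : 0 ≤ B₃) (hBi : 0 ≤ Bi)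
    (hBd : 0 ≤ Bd ε) (hBr : 0 ≤ Br) (hΛ : 0 ≤ Λ) (hα : 0 ≤ α) (hσ : 0 ≤ σ) (hε0 : 0 < ε) (hε1 : ε ≤ 1) (hρ₄ : 0 ≤ ρ₄)
    (hρ₄r : ρ₄ + 3 * σ ≤ (1 - α) * r) (hr : 0 ≤ r) (hr0 : r ≤ δ₀) (hr₃ : r ≤ δ₃) (hrK : r + σ ≤ δK) (hq : θ * c < 1)
    (hST : ScaleTransfer g r α Λ (fun y => g.len y ^ (1 : ℝ)))
    (hK1 : HasMaj (cNorm R₀ H₀ 𝔬.blk hG.lenle 1) (cNorm R₀ H₀ 𝔬.blk hG.lenle 1) (𝔬.G0 U ∘ₗ (𝔬.Tpi U + 𝔬.T2 U))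
      (fun a b => θ * Real.exp (-(δK * g.dist a b))))
    (hK2 : HasMaj (cNorm R₀ H₀ 𝔬.blk hG.lenle 2) (cNorm R₀ H₀ 𝔬.blk hG.lenle 2) (𝔬.G0 U ∘ₗ (𝔬.Tpi U + 𝔬.T2 U))
      (fun a b => θ * Real.exp (-(δK * g.dist a b))))
    (he0 : HasMajorant (g := toB6 g R₀ H₀) 𝔬.blk (𝔬.G0 U) (fun a b => B₀ * g.len a ^ 2 * Real.exp (-(δ₀ * g.dist a b))))
    (he2 : HasMajorantHom (g := toB6 g R₀ H₀) 𝔬.blkY 𝔬.blk (𝔬.G0 U ∘ₗ 𝔬.Dstar U)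
      (fun (a b : g.Site) => B₀ * g.len a * Real.exp (-(δ₀ * g.dist a b))))
    (hLS : LeftStep 𝔬 R₀ H₀ hG.lenle B₀ δ₀ θ' δK U)
    (h44 : HasMaj (bHY ε) (BlockNorm.ofBlocks (toB6 g R₀ H₀) 𝔬.blkY) (𝔬.D U ∘ₗ (𝔬.G0 U ∘ₗ 𝔬.Dstar U))
      (fun (a b : g.Site) => Bi * Real.exp (-(δ₀ * g.dist a b))))
    (htD : HasMaj (bHY ε) (cNormR R₀ H₀ 𝔬.blk hG.lenle 1) ((𝔬.Tpi U + 𝔬.T2 U) ∘ₗ (𝔬.G0 U ∘ₗ 𝔬.Dstar U))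
      (fun a b => θH * Real.exp (-(δK * g.dist a b))))
    {wZ : g.Site → ℝ} {hwZ : ∀ y, 0 < wZ y}
    (hL : Letters313Z 𝔬 R₀ H₀ hG wZ hwZ B₃ δ₃ U) (hLD : Letters313DZ 𝔬 R₀ H₀ hG wZ hwZ B₃ δ₃ bH U)
    (hLI : Letters313I 𝔬 𝔭 R₀ H₀ hG.lenle bHY bHW Br θv Bd Bd2 δ₃ δK U) (hI : Identities 𝔬 U) :
    HasMaj (bHY ε) (BlockNorm.ofBlocks (toB6 g R₀ H₀) 𝔬.blkY) (𝔬.D U ∘ₗ (𝔬.GG U ∘ₗ 𝔬.Dstar U))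
      (fun (a b : g.Site) => constI44 θ θ' θH θv B₀ B₃ Bi (Bd ε) Br Λ (bHW ε).κ c * Real.exp (-(ρ₄ * g.dist a b))) := by
  have hfix1 := fix_of_inverses hI.invG0' hI.invG1
  have hfixR := fix_right_of_inverses hI.invG0' hI.invG1
  have hq1 : 0 ≤ (1 - θ * c)⁻¹ := inv_nonneg.mpr (by linarith)
  have hA₁ : 0 ≤ B₀ * (1 - θ * c)⁻¹ := mul_nonneg hB₀ hq1
  have hA₃ : 0 ≤ B₃ * (1 - θ * c)⁻¹ := mul_nonneg hB₃ hq1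
  have hCL : 0 ≤ B₀ + θ' * (B₀ * (1 - θ * c)⁻¹) * c := add_nonneg hB₀ (mul_nonneg (mul_nonneg hθ' hA₁) hc)
  have hKQ' : 0 ≤ B₃ + θ' * (B₃ * (1 - θ * c)⁻¹) * c := add_nonneg hB₃ (mul_nonneg (mul_nonneg hθ' hA₃) hc)
  -- rates
  have h1α : (1 - α) * r ≤ r := by rw [sub_mul, one_mul]; exact sub_le_self _ (mul_nonneg hα hr)
  have hρ₂0 : 0 ≤ ρ₄ + 2 * σ := by linarith
  have hρ₂σ : ρ₄ + 2 * σ + σ ≤ (1 - α) * r := by linarith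
  have hρ₂α : ρ₄ + 2 * σ ≤ (1 - α) * r := by linarith
  have hρ₂r : ρ₄ + 2 * σ ≤ r := by linarith
  have hρ₂K : ρ₄ + 2 * σ ≤ δK := by linarith
  have hρ₂0' : ρ₄ + 2 * σ ≤ δ₀ := by linarith
  have hρ₂₃ : ρ₄ + 2 * σ ≤ δ₃ := by linarith
  have hρ₂₃σ : ρ₄ + 2 * σ + σ ≤ δ₃ := by linarith
  -- the proved sup entry ∇_UG₁ at the rate r
  have hm1 := entry1_of_stepD hG hrow hθ hθ' hB₀ hr hr0 hrK hK2 hLS.stepD1 he0 hLS.e1 hfix1 hq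
  -- ∇G₁∇* from `bHY ε` and ∇G₁D from `bHW ε` by the right form
  have hGop := input44_of_step hG hrow hθH hBi hCL hΛ hρ₂0 hρ₂σ hρ₂K hρ₂0' hST hm1 h44 htD hfixR
  have hGD := input44_of_stepV hG hrow hθv hBd hCL hΛ hρ₂0 hρ₂σ hρ₂K hρ₂₃ hST hm1 (hLI.dgDv ε hε0 hε1) (hLI.tDv ε hε0)
    hfixR
  -- ∇G₁Q* : Z_{wZ} → 𝔠_Y⁽¹⁾ by the left form, then (2.60) for the weighted source: Z_{len·wZ} → 𝔠_Y^{(0)}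
  have hGQr := hasMaj_right_of_step_weight hG hwZ hrow hθ hB₃ hr hr₃ hrK hK2 hL.gQs2 hfix1 hq
  have hDQ := hasMaj_left_right hG hrow hθ' hB₃ hA₃ hr hr₃ le_rfl hrK hLS.stepD1 hLD.dgQs hGQr hfix1
  have hDQR : HasMaj (weightNorm (BlockNorm.ofBlocks (toB6 g R₀ H₀) 𝔬.blkZ) wZ fun y => (hwZ y).le) (cNormR R₀ H₀ 𝔬.blkY hG.lenle (-1))
      (𝔬.D U ∘ₗ 𝔬.G1 U ∘ₗ 𝔬.Qstar U) (fun y y' => (B₃ + θ' * (B₃ * (1 - θ * c)⁻¹) * c) * Real.exp (-(r * g.dist y y'))) := by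
    have h := hasMaj_toR_tgt hG hDQ
    simp only [Nat.cast_one] at h
    exact h
  have hDQT := hasMaj_transfer_weight hG (fun y => (hwZ y).le) hKQ' hST hDQR
  have e2 : (-1 : ℝ) + 1 = 0 := by ring
  rw [e2] at hDQT
  have hGQ : HasMaj (weightNorm (BlockNorm.ofBlocks (toB6 g R₀ H₀) 𝔬.blkZ) (fun y => g.len y * wZ y) fun y => (wZlen_pos hG hwZ y).le)
      (BlockNorm.ofBlocks (toB6 g R₀ H₀) 𝔬.blkY) (𝔬.D U ∘ₗ 𝔬.G1 U ∘ₗ 𝔬.Qstar U)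
      (fun a b => (B₃ + θ' * (B₃ * (1 - θ * c)⁻¹) * c) * Λ * Real.exp (-((ρ₄ + 2 * σ) * g.dist a b))) :=
    hasMaj_of_out_zero (hDQT.of_rate_le hG.dnn (mul_nonneg hKQ' hΛ) hρ₂α)
  -- (3.153)
  have h := GG_input_of_piecesZ hG hrow hc hθ hB₀ hB₃ hBr (add_nonneg hBi (mul_nonneg (mul_nonneg (mul_nonneg hCL hΛ) hθH) hc))
    (add_nonneg hBd (mul_nonneg (mul_nonneg (mul_nonneg hCL hΛ) hθv) hc)) (mul_nonneg hKQ' hΛ) hσ hρ₄ le_rfl hρ₂r hρ₂₃σ hr hr0 hrK hq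
    hK1 he2 hL hI (hLI.domY ε hε0) (hLI.locY ε hε0) (hLI.rgd ε hε0) hGop hGD hGQ
  refine h.mono fun a b => le_of_eq ?_
  simp only [constI44]

omit [Fintype PX] in
/-- ★ **(3.45) FOR 𝔊 = 𝔓G₁, PRINTED SHAPE, COARSE LETTERS RE-CLASSED** (statement of `B9Thm313WholeInput.GG_input45_of_letters` over `Letters313Z`, `hpQ`
out of `Z_{wZ}`) — Φ^Y_β∘∇_U𝔊∇\*_U read from the input Hölder class `bHY (β+ε)` into the probe blocks:
‖ζ∇_U𝔊∇\*_Uμ‖_β-type bound K·(Lʲη)^{−β}·e^{−ρ₄d(y,y′)}(‖μ‖_{β+ε} + |μ|) (the input `h45` of n06-k's `lines3445_of_hasMaj_rel`), K = `constI45 … (bHW (β+ε)).κ c`.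
Route: (3.153) with E = Φ^Y_β∘∇_U in the real class 𝔠_P^{(β)} (`GG_input_of_pieces`); Φ^Y_β∇_UG₁∇\*_U and Φ^Y_β∇_UG₁D by the right form
(`input45_of_step` from Theorem 3.3 (3.45) for G₀ ∕ the letter `pdgDv`, the steps `tD1` ∕ `tDv`, the proved probe entry `probe43L_cNormR`);
Φ^Y_β∇_UG₁Q* by `hasMaj_left_rightR` (letters `hpQ` out of `Z_{wZ}`, `Letters313Z.gQs2`, the probe step `pY1`) transferred by (2.60) to `Z_{len·wZ}`.  Provisos as for (3.44).
[cite: Balaban1985BackgroundPropagators, Thm 3.13 p.426 + (3.153) p.426 + (3.45) p.398 + (3.43) p.398 + Thm 3.12 p.423 + p.398 (remark after (3.47)); Balaban1984PropagatorsII, Lemma 2.1 (2.60)–(2.61) p.234] -/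
theorem GG_input45_of_lettersZ (hG : GeoOK g) (𝔭 : HolderProbes g B X Y PX PY) {𝔬 : Ops g B X Y Z W} {U : B.Cfg}
    {bHY : ℝ → BlockNorm (toB6 g R₀ H₀) (Y → ℝ)} {bHW : ℝ → BlockNorm (toB6 g R₀ H₀) (W → ℝ)}
    {Bd : ℝ → ℝ} {Bd2 : ℝ → ℝ → ℝ} {θ θH θv B₀ B₃ Bh Bi2 Bq Br β δ₀ δ₃ δK r ρ₄ α Λ σ c ε : ℝ} (hrow : RowSum (toB6 g R₀ H₀) σ c)
    (hc : 0 ≤ c) (hθ : 0 ≤ θ) (hθH : 0 ≤ θH) (hθv : 0 ≤ θv) (hB₀ : 0 ≤ B₀) (hB₃ : 0 ≤ B₃) (hBh : 0 ≤ Bh) (hBi2 : 0 ≤ Bi2)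
    (hBq : 0 ≤ Bq) (hBd2 : 0 ≤ Bd2 ε β) (hBr : 0 ≤ Br) (hΛ : 0 ≤ Λ) (hα : 0 ≤ α) (hσ : 0 ≤ σ) (hε0 : 0 < ε) (hε1 : ε ≤ 1)
    (hβ0 : 0 ≤ β) (hβ1 : β < 1) (hρ₄ : 0 ≤ ρ₄) (hρ₄r : ρ₄ + 3 * σ ≤ (1 - α) * r) (hr : 0 ≤ r) (hr0 : r ≤ δ₀) (hr₃ : r ≤ δ₃)
    (hrK : r + σ ≤ δK) (hq : θ * c < 1) (hST : ScaleTransfer g r α Λ (fun y => g.len y ^ (1 : ℝ)))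
    (hK1 : HasMaj (cNorm R₀ H₀ 𝔬.blk hG.lenle 1) (cNorm R₀ H₀ 𝔬.blk hG.lenle 1) (𝔬.G0 U ∘ₗ (𝔬.Tpi U + 𝔬.T2 U))
      (fun a b => θ * Real.exp (-(δK * g.dist a b))))
    (hK2 : HasMaj (cNorm R₀ H₀ 𝔬.blk hG.lenle 2) (cNorm R₀ H₀ 𝔬.blk hG.lenle 2) (𝔬.G0 U ∘ₗ (𝔬.Tpi U + 𝔬.T2 U))
      (fun a b => θ * Real.exp (-(δK * g.dist a b))))
    (he0 : HasMajorant (g := toB6 g R₀ H₀) 𝔬.blk (𝔬.G0 U) (fun a b => B₀ * g.len a ^ 2 * Real.exp (-(δ₀ * g.dist a b))))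
    (he2 : HasMajorantHom (g := toB6 g R₀ H₀) 𝔬.blkY 𝔬.blk (𝔬.G0 U ∘ₗ 𝔬.Dstar U)
      (fun (a b : g.Site) => B₀ * g.len a * Real.exp (-(δ₀ * g.dist a b))))
    (h43 : HasMajorantHom (g := toB6 g R₀ H₀) 𝔬.blk 𝔭.blkPY (𝔭.ΦY U β ∘ₗ (𝔬.D U ∘ₗ 𝔬.G0 U))
      (fun (a b : g.Site) => Bh * g.len a ^ (1 - β) * Real.exp (-(δ₀ * g.dist a b))))
    (hpY : HasMaj (cNormR R₀ H₀ 𝔬.blk hG.lenle (-2)) (cNormR R₀ H₀ 𝔭.blkPY hG.lenle (β - 1))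
      ((𝔭.ΦY U β ∘ₗ 𝔬.D U ∘ₗ 𝔬.G0 U) ∘ₗ (𝔬.Tpi U + 𝔬.T2 U)) (fun a b => θH * Real.exp (-(δK * g.dist a b))))
    {wZ : g.Site → ℝ} {hwZ : ∀ y, 0 < wZ y}
    (hpQ : HasMaj (weightNorm (BlockNorm.ofBlocks (toB6 g R₀ H₀) 𝔬.blkZ) wZ fun y => (hwZ y).le) (cNormR R₀ H₀ 𝔭.blkPY hG.lenle (β - 1))
      ((𝔭.ΦY U β ∘ₗ 𝔬.D U ∘ₗ 𝔬.G0 U) ∘ₗ 𝔬.Qstar U) (fun a b => Bq * Real.exp (-(δ₃ * g.dist a b))))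
    (h45 : HasMaj (bHY (β + ε)) (BlockNorm.ofBlocks (toB6 g R₀ H₀) 𝔭.blkPY) (𝔭.ΦY U β ∘ₗ (𝔬.D U ∘ₗ (𝔬.G0 U ∘ₗ 𝔬.Dstar U)))
      (fun (a b : g.Site) => Bi2 * g.len a ^ (-β) * Real.exp (-(δ₀ * g.dist a b))))
    (htD : HasMaj (bHY (β + ε)) (cNormR R₀ H₀ 𝔬.blk hG.lenle 1) ((𝔬.Tpi U + 𝔬.T2 U) ∘ₗ (𝔬.G0 U ∘ₗ 𝔬.Dstar U))
      (fun a b => θH * Real.exp (-(δK * g.dist a b))))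
    (hL : Letters313Z 𝔬 R₀ H₀ hG wZ hwZ B₃ δ₃ U) (hLI : Letters313I 𝔬 𝔭 R₀ H₀ hG.lenle bHY bHW Br θv Bd Bd2 δ₃ δK U) (hI : Identities 𝔬 U) :
    HasMaj (bHY (β + ε)) (BlockNorm.ofBlocks (toB6 g R₀ H₀) 𝔭.blkPY) (𝔭.ΦY U β ∘ₗ (𝔬.D U ∘ₗ (𝔬.GG U ∘ₗ 𝔬.Dstar U)))
      (fun (a b : g.Site) => constI45 θ θH θv B₀ B₃ Bh Bi2 (Bd2 ε β) Bq Br Λ (bHW (β + ε)).κ c * g.len a ^ (-β) *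
        Real.exp (-(ρ₄ * g.dist a b))) := by
  have htri : Triangle254 (toB6 g R₀ H₀) := fun a b c => hG.tri a b c
  have hfix1 := fix_of_inverses hI.invG0' hI.invG1
  have hfixR := fix_right_of_inverses hI.invG0' hI.invG1
  have hq1 : 0 ≤ (1 - θ * c)⁻¹ := inv_nonneg.mpr (by linarith)
  have hA₁ : 0 ≤ B₀ * (1 - θ * c)⁻¹ := mul_nonneg hB₀ hq1
  have hA₃ : 0 ≤ B₃ * (1 - θ * c)⁻¹ := mul_nonneg hB₃ hq1
  have hCh : 0 ≤ Bh + θH * (B₀ * (1 - θ * c)⁻¹) * c := add_nonneg hBh (mul_nonneg (mul_nonneg hθH hA₁) hc)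
  have hKQ' : 0 ≤ Bq + θH * (B₃ * (1 - θ * c)⁻¹) * c := add_nonneg hBq (mul_nonneg (mul_nonneg hθH hA₃) hc)
  -- rates
  have h1α : (1 - α) * r ≤ r := by rw [sub_mul, one_mul]; exact sub_le_self _ (mul_nonneg hα hr)
  have hρ₂0 : 0 ≤ ρ₄ + 2 * σ := by linarith
  have hρ₂σ : ρ₄ + 2 * σ + σ ≤ (1 - α) * r := by linarith
  have hρ₂α : ρ₄ + 2 * σ ≤ (1 - α) * r := by linarith
  have hρ₂r : ρ₄ + 2 * σ ≤ r := by linarith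
  have hρ₂K : ρ₄ + 2 * σ ≤ δK := by linarith
  have hρ₂0' : ρ₄ + 2 * σ ≤ δ₀ := by linarith
  have hρ₂₃ : ρ₄ + 2 * σ ≤ δ₃ := by linarith
  have hρ₂₃σ : ρ₄ + 2 * σ + σ ≤ δ₃ := by linarith
  set E : (X → ℝ) →ₗ[ℝ] (PY → ℝ) := 𝔭.ΦY U β ∘ₗ 𝔬.D U with hE
  -- the proved probe entry Φ^Y_β∇_UG₁ : 𝔠^{(0)} → 𝔠_P^{(β−1)} at the rate r
  have h43' : HasMajorantHom (g := toB6 g R₀ H₀) 𝔬.blk 𝔭.blkPY (E ∘ₗ 𝔬.G0 U)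
      (fun (a b : g.Site) => Bh * g.len a ^ (1 - β) * Real.exp (-(δ₀ * g.dist a b))) := h43
  have hpY' : HasMaj (cNormR R₀ H₀ 𝔬.blk hG.lenle (-2)) (cNormR R₀ H₀ 𝔭.blkPY hG.lenle (β - 1))
      ((E ∘ₗ 𝔬.G0 U) ∘ₗ (𝔬.Tpi U + 𝔬.T2 U)) (fun a b => θH * Real.exp (-(δK * g.dist a b))) := hpY
  have hA := probe43L_cNormR hG hrow hθ hθH hB₀ hBh hr hr0 hrK hK2 he0 h43' hpY' hfix1 hq
  -- Φ∇G₁∇* from `bHY (β+ε)` and Φ∇G₁D from `bHW (β+ε)` by the right form, into 𝔠_P^{(β)}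
  have h45' : HasMaj (bHY (β + ε)) (BlockNorm.ofBlocks (toB6 g R₀ H₀) 𝔭.blkPY) (E ∘ₗ (𝔬.G0 U ∘ₗ 𝔬.Dstar U))
      (fun (a b : g.Site) => Bi2 * g.len a ^ (-β) * Real.exp (-(δ₀ * g.dist a b))) := h45
  have hGop' := input45_of_step hG hrow hθH hBi2 hCh hΛ hρ₂0 hρ₂σ hρ₂K hρ₂0' hST hA h45' htD hfixR
  have hGop : HasMaj (bHY (β + ε)) (cNormR R₀ H₀ 𝔭.blkPY hG.lenle β) (E ∘ₗ (𝔬.G1 U ∘ₗ 𝔬.Dstar U))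
      (fun a b => (Bi2 + (Bh + θH * (B₀ * (1 - θ * c)⁻¹) * c) * Λ * θH * c) * Real.exp (-((ρ₄ + 2 * σ) * g.dist a b))) :=
    hasMaj_weight_out hG (hGop'.mono fun a b => le_of_eq (by ring))
  have hε' : 0 < β + ε := by linarith
  have hGD' := input45_of_step hG hrow hθv hBd2 hCh hΛ hρ₂0 hρ₂σ hρ₂K hρ₂₃ hST hA (hLI.pdgDv ε β hε0 hε1 hβ0 hβ1)
    (hLI.tDv (β + ε) hε') hfixR
  have hGD : HasMaj (bHW (β + ε)) (cNormR R₀ H₀ 𝔭.blkPY hG.lenle β) (E ∘ₗ (𝔬.G1 U ∘ₗ 𝔬.Dv U))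
      (fun a b => (Bd2 ε β + (Bh + θH * (B₀ * (1 - θ * c)⁻¹) * c) * Λ * θv * c) * Real.exp (-((ρ₄ + 2 * σ) * g.dist a b))) :=
    hasMaj_weight_out hG (hGD'.mono fun a b => le_of_eq (by ring))
  -- Φ∇G₁Q* : Z_{wZ} → 𝔠_P^{(β−1)} by the left form over the real middle class 𝔠^{(−2)}, then (2.60): Z_{len·wZ} → 𝔠_P^{(β)}
  have hGQr : HasMaj (weightNorm (BlockNorm.ofBlocks (toB6 g R₀ H₀) 𝔬.blkZ) wZ fun y => (hwZ y).le) (cNormR R₀ H₀ 𝔬.blk hG.lenle (-2))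
      (𝔬.G1 U ∘ₗ 𝔬.Qstar U) (fun a b => B₃ * (1 - θ * c)⁻¹ * Real.exp (-(r * g.dist a b))) := by
    have h := hasMaj_toR_tgt hG (hasMaj_right_of_step_weight hG hwZ hrow hθ hB₃ hr hr₃ hrK hK2 hL.gQs2 hfix1 hq)
    simp only [Nat.cast_ofNat] at h
    exact h
  have hpQ' : HasMaj (weightNorm (BlockNorm.ofBlocks (toB6 g R₀ H₀) 𝔬.blkZ) wZ fun y => (hwZ y).le) (cNormR R₀ H₀ 𝔭.blkPY hG.lenle (β - 1))
      (E ∘ₗ 𝔬.G0 U ∘ₗ 𝔬.Qstar U) (fun a b => Bq * Real.exp (-(δ₃ * g.dist a b))) := hpQ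
  have hKE : HasMaj (cNormR R₀ H₀ 𝔬.blk hG.lenle (-2)) (cNormR R₀ H₀ 𝔭.blkPY hG.lenle (β - 1))
      (E ∘ₗ 𝔬.G0 U ∘ₗ (𝔬.Tpi U + 𝔬.T2 U)) (fun a b => θH * Real.exp (-(δK * g.dist a b))) := hpY
  have hDQ := hasMaj_left_rightR hG hrow hθH hBq hA₃ hr hr₃ le_rfl hrK hKE hpQ' hGQr hfix1
  have hDQT := hasMaj_transfer_weight hG (fun y => (hwZ y).le) hKQ' hST hDQ
  have e2 : β - 1 + 1 = β := by ring
  rw [e2] at hDQT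
  have hGQ : HasMaj (weightNorm (BlockNorm.ofBlocks (toB6 g R₀ H₀) 𝔬.blkZ) (fun y => g.len y * wZ y) fun y => (wZlen_pos hG hwZ y).le)
      (cNormR R₀ H₀ 𝔭.blkPY hG.lenle β) (E ∘ₗ 𝔬.G1 U ∘ₗ 𝔬.Qstar U)
      (fun a b => (Bq + θH * (B₃ * (1 - θ * c)⁻¹) * c) * Λ * Real.exp (-((ρ₄ + 2 * σ) * g.dist a b))) :=
    hDQT.of_rate_le hG.dnn (mul_nonneg hKQ' hΛ) hρ₂α
  -- (3.153) in 𝔠_P^{(β)}, then unweighted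
  have h := GG_input_of_piecesZ hG hrow hc hθ hB₀ hB₃ hBr (add_nonneg hBi2 (mul_nonneg (mul_nonneg (mul_nonneg hCh hΛ) hθH) hc))
    (add_nonneg hBd2 (mul_nonneg (mul_nonneg (mul_nonneg hCh hΛ) hθv) hc)) (mul_nonneg hKQ' hΛ) hσ hρ₄ le_rfl hρ₂r hρ₂₃σ hr hr0 hrK hq
    hK1 he2 hL hI (hLI.domY (β + ε) hε') (hLI.locY (β + ε) hε') (hLI.rgd (β + ε) hε') hGop hGD hGQ
  have hu := hasMaj_unweight_out hG h
  refine hu.mono fun a b => le_of_eq ?_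
  simp only [constI45]
  ring

end OneMember

end

end Literature.MathematicalPhysics.QuantumFieldTheory.Balaban1983to89.B9Thm313WholeInputZ
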